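import Summits.ABC.ABC.Theorems.CongruentialReceptacleTameLocalReceptacleKeyCellDefs
import Literature.NumberTheory.Sieve.SmoothCharacterSumBound

/-!
# Crux `CongruentialReceptacle.TameLocalReceptacle` (stmt-ABC-14354), line `grh-friable-cell-resolution`:
# the Mellin step `SmoothLLindelof → FriableCharSumBound`

Registered stub `stub_friableCharSums_of_lindelof` of the checked skeleton
`Cruxes/TameLocalReceptacle/Lines/grh_friable_cell_resolution.lean` (lead `prover-line-stmt-ABC-14354-a1-0`),
with the vocabulary of `CongruentialReceptacleTameLocalReceptacleKeyCellDefs.lean`.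

From the Lindelöf-type bound `‖L(s, χ; y)‖ ≤ C₁ (q(1+|Im s|))^{ε'}` on `Re s ≥ 1/2 + ε'` for the partial Euler
products `L(s, χ; y) = ∏_{p ≤ y} (1 − χ(p)p^{−s})⁻¹` (`TwistedWeight.smoothLC`; hypothesis `SmoothLLindelof`) we
derive the power-saving bound `‖∑_{n ∈ S(X,y)} χ(n) W_λ(n/X)‖ ≤ C (1+|λ|)³ X^{1/2+ε} q^ε` for the character-twisted
friable sums weighted by `W_λ(v) = v²(1−v)² e(λv)` (`TwistedWeight.twistWeight`; conclusion `FriableCharSumBound`).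
The proof is the Mellin step: the PROVED identity `TwistedWeight.sum_char_twistWeight_eq_integral`,
`∑_{n ∈ S(X,y)} χ(n) W_λ(n/X) = (2π)⁻¹ ∫ X^{σ+it} Ŵ_λ(σ+it) L(σ+it, χ; y) dt`, is read on the line `σ = 1/2 + ε`;
the integrand is majorised by `X^σ · C₁ q^ε · 4(1 + C_λ)/(1 + t²)` using `‖Ŵ_λ‖ ≤ 1`
(`norm_twistMellin_le_one`), `‖Ŵ_λ(s)‖ ≤ C_λ/(|s+2||s+3||s+4|) ≤ C_λ/|t|³` (`norm_twistMellin_le_decay`,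
`C_λ = 2 + 6(2π|λ|) + 6(2π|λ|)² + (2π|λ|)³`) and `(q(1+|t|))^{ε'} ≤ q^ε (1+|t|)` for `ε' = min ε 1`; finally
`∫ dt/(1+t²) = π` and `1 + C_λ ≤ (2π)³ (1+|λ|)³`, so that `C = 2 (2π)³ C₁` works.  The structure is that of
`TwistedWeight.norm_char_smoothSum_le` (`Literature/NumberTheory/Sieve/SmoothCharacterSumBound.lean`).

References: A. J. Harper, Compositio Math. 152 (2016), §2.2 and Appendix [Harper2016] (Mellin treatment of
character-twisted smooth sums); the hypothesis `SmoothLLindelof` is, under GRH, Lagarias–Soundararajan (2012), Prop. 5.1.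

Deliberately NOT here: the GRH input (`stub_smoothLLindelof_of_grh`, another stub of the line) and any use of the
bound (the key-cell stubs); this file is the unconditional implication only.
-/

-- `Summit.<Summit>.<Problem>` is the mandated summit-side namespace (CONVENTIONS §2); for the
-- single-conjunct summit `ABC` the two coincide, so the duplicate `ABC.ABC` is deliberate.
set_option linter.dupNamespace false

namespace Summit.ABC.ABC.Theorems.TameLocalReceptacle

open Real Complex MeasureTheory Set Filter
open Literature.NumberTheory.Sieve
open Literature.NumberTheory.Sieve.TwistedWeight

/-- The constant of `norm_twistMellin_le_decay` plus one is at most `(2π)³ (1 + |λ|)³`: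
`3 + 6(2π|λ|) + 6(2π|λ|)² + (2π|λ|)³ ≤ (2π)³ (1 + |λ|)³` (termwise, since `2π ≥ 6`). [folklore] -/
theorem one_add_twistMellinConst_le_cube (lam : ℝ) :
    1 + (2 + 6 * (2 * π * |lam|) + 6 * (2 * π * |lam|) ^ 2 + (2 * π * |lam|) ^ 3) ≤
      (2 * π) ^ 3 * (1 + |lam|) ^ 3 := by
  set u : ℝ := 2 * π with hu
  set A : ℝ := |lam| with hA
  have hu6 : 6 ≤ u := by have := Real.pi_gt_three; rw [hu]; linarith
  have hA0 : 0 ≤ A := abs_nonneg lam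
  have hu0 : 0 ≤ u := by linarith
  have hu2 : 36 ≤ u ^ 2 := by nlinarith
  have hu3 : 216 ≤ u ^ 3 := by nlinarith
  have h1 : (3 : ℝ) ≤ u ^ 3 := by linarith
  have h2 : 6 * u ≤ 3 * u ^ 3 := by nlinarith
  have h3 : 6 * u ^ 2 ≤ 3 * u ^ 3 := by nlinarith
  have h2' : 6 * u * A ≤ 3 * u ^ 3 * A := mul_le_mul_of_nonneg_right h2 hA0
  have h3' : 6 * u ^ 2 * A ^ 2 ≤ 3 * u ^ 3 * A ^ 2 := mul_le_mul_of_nonneg_right h3 (sq_nonneg A)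
  have hA3 : 0 ≤ u ^ 3 * A ^ 3 := by positivity
  have hexp : u ^ 3 * (1 + A) ^ 3 = u ^ 3 + 3 * u ^ 3 * A + 3 * u ^ 3 * A ^ 2 + u ^ 3 * A ^ 3 := by ring
  have hlhs : 1 + (2 + 6 * (u * A) + 6 * (u * A) ^ 2 + (u * A) ^ 3) =
      3 + 6 * u * A + 6 * u ^ 2 * A ^ 2 + u ^ 3 * A ^ 3 := by ring
  rw [hexp, hlhs]
  linarith

/-- **Registered stub `stub_friableCharSums_of_lindelof`** (line `grh-friable-cell-resolution` of crux
stmt-ABC-14354): the Lindelöf-type bound for the partial Euler products `L(s, χ; y)` on `Re s ≥ 1/2 + ε`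
(`SmoothLLindelof`) implies the power-saving bound
`‖∑_{n ∈ S(X,y)} χ(n) W_λ(n/X)‖ ≤ C (1+|λ|)³ X^{1/2+ε} q^ε` for non-principal `χ mod q`, `q ≠ 0`, `X ≥ 1`
(`FriableCharSumBound`), by Mellin inversion on the line `Re s = 1/2 + ε` (see the module docstring; the constant
is `C = 2 (2π)³ C₁(min ε 1)`). [cite: Harper2016, §2.2] -/
theorem stub_friableCharSums_of_lindelof : SmoothLLindelof → FriableCharSumBound := by
  intro hL ε hε
  -- the Lindelöf constant at `ε' = min ε 1`
  obtain ⟨C₁, hC₁, hLb⟩ := hL (min ε 1) (lt_min hε one_pos)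
  refine ⟨2 * (2 * π) ^ 3 * C₁, by positivity, ?_⟩
  intro q χ hq hχ y X lam hX
  have hX0 : 0 < X := by linarith
  have hq1 : (1 : ℝ) ≤ q := by exact_mod_cast Nat.one_le_iff_ne_zero.mpr hq
  set σ : ℝ := 1 / 2 + ε with hσdef
  have hσ0 : 0 < σ := by rw [hσdef]; linarith
  set Cl : ℝ := 2 + 6 * (2 * π * |lam|) + 6 * (2 * π * |lam|) ^ 2 + (2 * π * |lam|) ^ 3 with hCl
  have hCl0 : 0 ≤ Cl := by have := Real.pi_pos; positivity
  -- the constant in front of `1/(1+t²)` in the majorant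
  set A : ℝ := X ^ σ * (C₁ * (q : ℝ) ^ ε) * (4 * (1 + Cl)) with hA
  rw [sum_char_twistWeight_eq_integral hX0 hσ0 y χ lam, norm_smul, Real.norm_eq_abs,
    abs_of_pos (by positivity : (0 : ℝ) < 1 / (2 * π))]
  -- the integrand and its majorant
  set F : ℝ → ℂ := fun t => (X : ℂ) ^ ((σ : ℂ) + t * I) * twistMellin lam (σ + t * I) *
    smoothLC χ ((σ : ℂ) + t * I) y with hF
  set M : ℝ → ℝ := fun t => A * (1 + t ^ 2)⁻¹ with hM
  have hXpow : ∀ t : ℝ, ‖(X : ℂ) ^ ((σ : ℂ) + t * I)‖ = X ^ σ := fun t => by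
    rw [Complex.norm_cpow_eq_rpow_re_of_pos hX0]; simp
  -- `‖L(σ+it, χ; y)‖ ≤ C₁ q^ε (1 + |t|)`
  have hLt : ∀ t : ℝ, ‖smoothLC χ ((σ : ℂ) + t * I) y‖ ≤ C₁ * (q : ℝ) ^ ε * (1 + |t|) := by
    intro t
    have hre' : ((σ : ℂ) + t * I).re = σ := by simp
    have hre : 1 / 2 + min ε 1 ≤ ((σ : ℂ) + t * I).re := by
      rw [hre', hσdef]; linarith [min_le_left ε 1]
    have him : ((σ : ℂ) + t * I).im = t := by simp
    have h := hLb q χ hq hχ y ((σ : ℂ) + t * I) hre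
    rw [him] at h
    refine h.trans ?_
    have h1 : ((q : ℝ) * (1 + |t|)) ^ (min ε 1) = (q : ℝ) ^ (min ε 1) * (1 + |t|) ^ (min ε 1) :=
      Real.mul_rpow (by positivity) (by positivity)
    have h2 : (q : ℝ) ^ (min ε 1) ≤ (q : ℝ) ^ ε := Real.rpow_le_rpow_of_exponent_le hq1 (min_le_left ε 1)
    have h3 : (1 + |t|) ^ (min ε 1) ≤ 1 + |t| := by
      have h := Real.rpow_le_rpow_of_exponent_le (by linarith [abs_nonneg t] : (1 : ℝ) ≤ 1 + |t|)
        (min_le_right ε 1)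
      rwa [Real.rpow_one] at h
    calc C₁ * ((q : ℝ) * (1 + |t|)) ^ (min ε 1)
        = C₁ * ((q : ℝ) ^ (min ε 1) * (1 + |t|) ^ (min ε 1)) := by rw [h1]
      _ ≤ C₁ * ((q : ℝ) ^ ε * (1 + |t|)) :=
          mul_le_mul_of_nonneg_left (mul_le_mul h2 h3 (by positivity) (by positivity)) hC₁.le
      _ = C₁ * (q : ℝ) ^ ε * (1 + |t|) := by ring
  -- `(1 + |t|) ‖Ŵ_λ(σ+it)‖ ≤ 4(1 + C_λ)/(1 + t²)`
  have hWt : ∀ t : ℝ, (1 + |t|) * ‖twistMellin lam (σ + t * I)‖ ≤ 4 * (1 + Cl) * (1 + t ^ 2)⁻¹ := by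
    intro t
    have hs : 0 < ((σ : ℂ) + t * I).re := by simp; exact hσ0
    rw [← div_eq_mul_inv, le_div_iff₀ (by positivity)]
    rcases le_or_gt |t| 1 with ht | ht
    · -- `|t| ≤ 1`: `‖Ŵ‖ ≤ 1`
      have hW1 : ‖twistMellin lam (σ + t * I)‖ ≤ 1 := norm_twistMellin_le_one hs.le lam
      have ht2 : t ^ 2 ≤ 1 := by
        rw [← sq_abs]; nlinarith [abs_nonneg t]
      calc (1 + |t|) * ‖twistMellin lam (σ + t * I)‖ * (1 + t ^ 2) ≤ 2 * 1 * 2 := by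
            apply mul_le_mul (mul_le_mul (by linarith) hW1 (norm_nonneg _) (by norm_num)) (by linarith)
              (by positivity) (by norm_num)
        _ ≤ 4 * (1 + Cl) := by linarith
    · -- `|t| > 1`: `‖Ŵ‖ ≤ C_λ/|t|³`
      have hWd := norm_twistMellin_le_decay hs lam
      rw [← hCl] at hWd
      have habs0 : 0 < |t| := lt_trans one_pos ht
      have hge : ∀ k : ℝ, |t| ≤ ‖(σ : ℂ) + t * I + k‖ := by
        intro k
        have : |((σ : ℂ) + t * I + k).im| ≤ ‖(σ : ℂ) + t * I + k‖ := Complex.abs_im_le_norm _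
        simpa using this
      have hprod : |t| ^ 3 ≤ ‖(σ : ℂ) + t * I + 2‖ * ‖(σ : ℂ) + t * I + 3‖ * ‖(σ : ℂ) + t * I + 4‖ := by
        have h2 := hge 2; have h3 := hge 3; have h4 := hge 4
        push_cast at h2 h3 h4
        calc |t| ^ 3 = |t| * |t| * |t| := by ring
          _ ≤ _ := by
            apply mul_le_mul (mul_le_mul h2 h3 (abs_nonneg _) (norm_nonneg _)) h4 (abs_nonneg _)
              (by positivity)
      have hW' : ‖twistMellin lam (σ + t * I)‖ ≤ Cl / |t| ^ 3 :=
        hWd.trans (div_le_div_of_nonneg_left hCl0 (by positivity) hprod)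
      have hW'' : ‖twistMellin lam (σ + t * I)‖ * |t| ^ 3 ≤ Cl := (le_div_iff₀ (by positivity)).1 hW'
      have ht2 : 1 ≤ t ^ 2 := by
        rw [← sq_abs]; nlinarith
      have hpoly : (1 + |t|) * (1 + t ^ 2) ≤ 4 * |t| ^ 3 := by
        have h1 : 1 + |t| ≤ 2 * |t| := by linarith
        have h2 : 1 + t ^ 2 ≤ 2 * |t| ^ 2 := by rw [sq_abs]; linarith
        calc (1 + |t|) * (1 + t ^ 2) ≤ (2 * |t|) * (2 * |t| ^ 2) :=
              mul_le_mul h1 h2 (by positivity) (by positivity)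
          _ = 4 * |t| ^ 3 := by ring
      calc (1 + |t|) * ‖twistMellin lam (σ + t * I)‖ * (1 + t ^ 2)
          = ((1 + |t|) * (1 + t ^ 2)) * ‖twistMellin lam (σ + t * I)‖ := by ring
        _ ≤ (4 * |t| ^ 3) * ‖twistMellin lam (σ + t * I)‖ :=
            mul_le_mul_of_nonneg_right hpoly (norm_nonneg _)
        _ = 4 * (‖twistMellin lam (σ + t * I)‖ * |t| ^ 3) := by ring
        _ ≤ 4 * Cl := by linarith
        _ ≤ 4 * (1 + Cl) := by linarith
  -- pointwise bound `‖F t‖ ≤ M t`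
  have hpt : ∀ t : ℝ, ‖F t‖ ≤ M t := by
    intro t
    simp only [hF, hM, norm_mul, hXpow t]
    calc X ^ σ * ‖twistMellin lam (σ + t * I)‖ * ‖smoothLC χ ((σ : ℂ) + t * I) y‖
        ≤ X ^ σ * ‖twistMellin lam (σ + t * I)‖ * (C₁ * (q : ℝ) ^ ε * (1 + |t|)) :=
          mul_le_mul_of_nonneg_left (hLt t) (by positivity)
      _ = X ^ σ * (C₁ * (q : ℝ) ^ ε) * ((1 + |t|) * ‖twistMellin lam (σ + t * I)‖) := by ring
      _ ≤ X ^ σ * (C₁ * (q : ℝ) ^ ε) * (4 * (1 + Cl) * (1 + t ^ 2)⁻¹) :=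
          mul_le_mul_of_nonneg_left (hWt t) (by positivity)
      _ = A * (1 + t ^ 2)⁻¹ := by rw [hA]; ring
  -- integrability of the majorant and its integral
  have hMint : Integrable M := by
    simp only [hM]
    exact integrable_inv_one_add_sq.const_mul A
  have hMval : ∫ t, M t = A * π := by
    simp only [hM]
    rw [integral_const_mul, integral_univ_inv_one_add_sq]
  have hmain := one_add_twistMellinConst_le_cube lam
  rw [← hCl] at hmain
  calc 1 / (2 * π) * ‖∫ t, F t‖ ≤ 1 / (2 * π) * ∫ t, M t := by
        apply mul_le_mul_of_nonneg_left _ (by positivity)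
        exact norm_integral_le_of_norm_le hMint (Eventually.of_forall hpt)
    _ = 2 * C₁ * (1 + Cl) * X ^ σ * (q : ℝ) ^ ε := by
        rw [hMval, hA]; field_simp; ring
    _ ≤ 2 * C₁ * ((2 * π) ^ 3 * (1 + |lam|) ^ 3) * X ^ σ * (q : ℝ) ^ ε :=
        mul_le_mul_of_nonneg_right (mul_le_mul_of_nonneg_right
          (mul_le_mul_of_nonneg_left hmain (by positivity)) (by positivity)) (by positivity)
    _ = 2 * (2 * π) ^ 3 * C₁ * (1 + |lam|) ^ 3 * X ^ σ * (q : ℝ) ^ ε := by ring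

end Summit.ABC.ABC.Theorems.TameLocalReceptacle
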